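import Literature.Probability.RandomPlanarGeometry.SLEThrPieces
import Literature.Probability.RandomPlanarGeometry.LoewnerThrPieces
import Literature.Probability.RandomPlanarGeometry.SLEImageBM
import Literature.Probability.RandomPlanarGeometry.LoewnerShiftAtContact
import HarnessLib

/-!
# The through-swallow image chain of SLE₆: the level-`n` piece martingales

Sequel of `SLEThrPieces` (Lawler–Schramm–Werner (2001) Thm. 2.2 / G. F. Lawler (2005) §6.3 Thm. 6.13,
gluing of the image driving martingales through the swallow instants). Theorems only:

* `sum_powerset_telescope` — `∑_{s ⊆ I} (F (b_s ∧ h) − F ((a_s ∧ b_s) ∧ h)) = F h − F 0` (the pieces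
  `[a_s, b_s)` partition the time axis; induction removing an index of maximal hitting time);
* `isStoppingTime_hullHitTime_drvK`, `isStoppingTime_thrRho`, `isStoppingTime_thrSigma` — stopping times;
* the interface of the level-`n` piece processes `pieceMart`, `pieceClock`: continuous strongly adapted
  (`continuous_pieceMart`, `stronglyAdapted_pieceMart`, `pieceClock_spec`), martingales with martingale
  compensated squares at `κ = 6` (`martingale_pieceMart`, `martingale_pieceMart_sq_sub`, from
  `martingale_imgMartK` / `martingale_imgBracket` and the two Brownian martingales), eventually equal to the
  image driving function and capacity clock of the piece hull at its alive times
  (`eventually_pieceMart_eq`), bounded up to the cap time (`abs_pieceMart_le`), and converging at the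
  contact time of the piece hull to the glued values (`tendsto_pieceMart_of_hullHitTime_eq`).

## References

* G. F. Lawler, O. Schramm, W. Werner, Acta Math. **187** (2001), Thm. 2.2. [LawlerSchrammWerner2001]
* G. F. Lawler (2005), §6.3 Thm. 6.13. [Lawler2005]
* D. Revuz, M. Yor (1999), Ch. II Prop. (1.2). [RevuzYor1999]
-/

noncomputable section

open Set Filter Metric Function MeasureTheory
open _root_.Complex _root_.Topology
open scoped NNReal

namespace Literature.Probability.RandomPlanarGeometry

open Loewner

/-! ### Telescoping over the pieces indexed by the subsets of a finite family -/

/-- **Telescoping over the level sets of a monotone step function**: for hitting times `T i ∈ [0, ∞]`,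
`a s = max_{i ∈ s} T i`, `b s = min_{i ∉ s} T i`, the nonempty intervals `[a s, b s)` partition `[0, ∞)`, so
`∑_{s ⊆ I} (F (b s ∧ h) − F ((a s ∧ b s) ∧ h)) = F h − F 0` (induction on `I`, removing an index of maximal
hitting time). [folklore] -/
theorem sum_powerset_telescope {ι : Type*} [DecidableEq ι] (I : Finset ι) (T : ι → WithTop ℝ≥0)
    (F : WithTop ℝ≥0 → ℝ) (h : WithTop ℝ≥0) :
    ∑ s ∈ I.powerset, (F (min ((I \ s).inf T) h) - F (min (min (s.sup T) ((I \ s).inf T)) h)) =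
      F h - F (min ⊥ h) := by
  induction I using Finset.induction_on_max_value T with
  | empty => simp
  | insert i I hi hmax ih =>
    rw [Finset.powerset_insert, Finset.sum_union, Finset.sum_image, ← Finset.sum_add_distrib, ← ih]
    · refine Finset.sum_congr rfl fun s hs ↦ ?_
      have hsI : s ⊆ I := Finset.mem_powerset.1 hs
      have his : i ∉ s := fun h' ↦ hi (hsI h')
      have hsup : s.sup T ≤ T i := Finset.sup_le fun x hx ↦ hmax x (hsI hx)
      rw [Finset.insert_sdiff_of_notMem _ his, Finset.inf_insert, Finset.insert_sdiff_insert,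
        Finset.sdiff_insert_of_notMem hi, Finset.sup_insert, sup_eq_left.2 hsup]
      have e : min (s.sup T) (min (T i) ((I \ s).inf T)) = min (s.sup T) ((I \ s).inf T) := by
        rw [← min_assoc, min_eq_left hsup]
      rw [e]
      ring
    · intro s hs s' hs' heq
      have his : i ∉ s := fun h' ↦ hi (Finset.mem_powerset.1 (Finset.mem_coe.1 hs) h')
      have his' : i ∉ s' := fun h' ↦ hi (Finset.mem_powerset.1 (Finset.mem_coe.1 hs') h')
      rw [← Finset.erase_insert his, heq, Finset.erase_insert his']
    · rw [Finset.disjoint_left]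
      intro s hs hs'
      obtain ⟨s', -, rfl⟩ := Finset.mem_image.1 hs'
      exact hi (Finset.mem_powerset.1 hs (Finset.mem_insert_self i s'))

namespace Loewner

/-- The clock of the empty hull is the identity. [folklore] -/
theorem imageClock_empty (W : ℝ≥0 → ℝ) (t : ℝ) : imageClock W ∅ t = t := by
  rw [imageClock]
  simp only [imageClockRate_empty, intervalIntegral.integral_const, smul_eq_mul, mul_one, sub_zero]

end Loewner

section Stopping

variable (κ : ℝ≥0) {A : Set ℂ} {hA : IsStarHull A} {δ : ℝ} {hδ : 0 < δ} {H : (ℝ≥0 → ℝ) → WithTop ℝ≥0}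

/-- **The hull hitting time of a nonempty `*`-hull is a stopping time** of the Brownian filtration
(`measurableSet_sleAlive`). [cite: LawlerSchrammWerner2003Restriction, §5 (T = T_A)] -/
theorem isStoppingTime_hullHitTime_drvK {B : Set ℂ} (hB : IsStarHull B) (hne : B.Nonempty) :
    IsStoppingTime brownianFiltration fun ω ↦ hullHitTime (drvK κ (brownianCPath ω)) B := by
  intro i
  have h := measurableSet_sleAlive κ hB hne i
  have heq : {ω | hullHitTime (drvK κ (brownianCPath ω)) B ≤ i} = {ω | Disjoint (closedHull (sleDriving κ ω) i) B}ᶜ := by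
    ext ω
    simp only [mem_setOf_eq, mem_compl_iff]
    rw [← drvK_brownianCPath, disjoint_closedHull_iff_lt_hullHitTime (continuous_drvK κ _) hB hne, not_lt]
  rw [heq]
  exact h.compl

/-- A finite supremum of stopping times is a stopping time. [folklore] -/
theorem isStoppingTime_finsetSup {Ω ι : Type*} {m : MeasurableSpace Ω} {𝓕 : Filtration ℝ≥0 m} [DecidableEq ι]
    (I : Finset ι) {τ : ι → Ω → WithTop ℝ≥0} (h : ∀ i ∈ I, IsStoppingTime 𝓕 (τ i)) :
    IsStoppingTime 𝓕 fun ω ↦ I.sup fun i ↦ τ i ω := by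
  induction I using Finset.induction_on with
  | empty => intro j; simp
  | insert a I ha ih =>
    simp only [Finset.sup_insert]
    exact (h a (Finset.mem_insert_self a I)).max (ih fun i hi ↦ h i (Finset.mem_insert_of_mem hi))

/-- A finite infimum of stopping times is a stopping time. [folklore] -/
theorem isStoppingTime_finsetInf {Ω ι : Type*} {m : MeasurableSpace Ω} {𝓕 : Filtration ℝ≥0 m} [DecidableEq ι]
    (I : Finset ι) {τ : ι → Ω → WithTop ℝ≥0} (h : ∀ i ∈ I, IsStoppingTime 𝓕 (τ i)) :
    IsStoppingTime 𝓕 fun ω ↦ I.inf fun i ↦ τ i ω := by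
  induction I using Finset.induction_on with
  | empty => intro j; simp
  | insert a I ha ih =>
    simp only [Finset.inf_insert]
    exact (h a (Finset.mem_insert_self a I)).min (ih fun i hi ↦ h i (Finset.mem_insert_of_mem hi))

/-- The piece start is a stopping time. [folklore] -/
theorem isStoppingTime_pieceStart (hA : IsStarHull A) (hδ : 0 < δ) {s : Finset (Set ℂ)} (hs : s ⊆ clusterFinset hA hδ) :
    IsStoppingTime brownianFiltration fun ω ↦ Loewner.pieceStart (drvK κ (brownianCPath ω)) s := by
  classical
  refine isStoppingTime_finsetSup s fun Q hQ ↦ ?_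
  obtain ⟨-, hQne, -, -, hQ⟩ := clusterFinset_spec hA hδ (hs hQ)
  exact isStoppingTime_hullHitTime_drvK κ hQ hQne

/-- The piece end is a stopping time. [folklore] -/
theorem isStoppingTime_pieceEnd (hA : IsStarHull A) (hδ : 0 < δ) (s : Finset (Set ℂ)) :
    IsStoppingTime brownianFiltration fun ω ↦ Loewner.pieceEnd (drvK κ (brownianCPath ω)) (clusterFinset hA hδ) s := by
  classical
  refine isStoppingTime_finsetInf _ fun Q hQ ↦ ?_
  obtain ⟨-, hQne, -, -, hQ⟩ := clusterFinset_spec hA hδ (Finset.mem_sdiff.1 hQ).1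
  exact isStoppingTime_hullHitTime_drvK κ hQ hQne

variable {κ}

/-- `ρ_s` is a stopping time. [folklore] -/
theorem isStoppingTime_thrRho (hH : IsStoppingTime brownianFiltration H) {s : Finset (Set ℂ)} (hs : s ⊆ clusterFinset hA hδ) :
    IsStoppingTime brownianFiltration (thrRho κ hA hδ H s) :=
  ((isStoppingTime_pieceStart κ hA hδ hs).min (isStoppingTime_pieceEnd κ hA hδ s)).min hH

/-- `σ_s` is a stopping time. [folklore] -/
theorem isStoppingTime_thrSigma (hH : IsStoppingTime brownianFiltration H) (s : Finset (Set ℂ)) :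
    IsStoppingTime brownianFiltration (thrSigma κ hA hδ H s) :=
  (isStoppingTime_pieceEnd κ hA hδ s).min hH

end Stopping

/-- **Up to and including the cap time the driver is bounded by `N + 1`.** [folklore] -/
theorem abs_drvK_le_of_le_capTimeK {κ : ℝ≥0} {N : ℕ} {s : ℝ≥0} {ω : ℝ≥0 → ℝ} (hs : (s : WithTop ℝ≥0) ≤ capTimeK κ N ω) :
    |drvK κ (brownianCPath ω) s| ≤ (N : ℝ) + 1 := by
  rcases hs.lt_or_eq with hlt | heq
  · exact (abs_drvK_lt_of_lt_capTimeK hlt).le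
  · rcases eq_or_ne s 0 with rfl | hs0
    · rw [drvK_zero, abs_zero]; positivity
    · haveI : (𝓝[<] s).NeBot := nhdsLT_neBot_of_exists_lt ⟨0, pos_iff_ne_zero.2 hs0⟩
      have hev : ∀ᶠ r in 𝓝[<] s, |drvK κ (brownianCPath ω) r| ≤ (N : ℝ) + 1 := by
        filter_upwards [self_mem_nhdsWithin] with r hr
        have hr' : (r : WithTop ℝ≥0) < capTimeK κ N ω := by rw [← heq]; exact_mod_cast hr
        exact (abs_drvK_lt_of_lt_capTimeK hr').le
      have hc : Continuous fun r ↦ |drvK κ (brownianCPath ω) r| := (continuous_drvK κ _).abs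
      exact le_of_tendsto (hc.continuousAt.tendsto.mono_left nhdsWithin_le_nhds) hev

/-! ### The level-`n` piece martingales: interface -/

section PieceMart

variable {κ : ℝ≥0} {A : Set ℂ} {hA : IsStarHull A} {δ : ℝ} {hδ : 0 < δ}

/-- The driving process `(t, ω) ↦ W_t(ω) = √κ B_t(ω)` is a continuous strongly adapted process. [folklore] -/
theorem stronglyAdapted_drvK_brownianCPath (κ : ℝ≥0) :
    StronglyAdapted brownianFiltration fun t (ω : ℝ≥0 → ℝ) ↦ drvK κ (brownianCPath ω) t := fun _ ↦
  (measurable_drvK_brownianCPath_of_le le_rfl).stronglyMeasurable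

/-- **The paths of the piece martingales are continuous.** [folklore] -/
theorem continuous_pieceMart {s : Finset (Set ℂ)} (hs : s ⊆ clusterFinset hA hδ) (n : ℕ) (ω : ℝ≥0 → ℝ) :
    Continuous fun t ↦ pieceMart κ hA hδ s n t ω := by
  rcases eq_or_ne s (clusterFinset hA hδ) with rfl | hne
  · rw [pieceMart_clusterFinset]; exact continuous_drvK κ _
  · rw [pieceMart_of_ne hs hne]; exact continuous_imgMartK n ω

/-- **The piece martingales are strongly adapted.** [folklore] -/
theorem stronglyAdapted_pieceMart {s : Finset (Set ℂ)} (hs : s ⊆ clusterFinset hA hδ) (n : ℕ) :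
    StronglyAdapted brownianFiltration (pieceMart κ hA hδ s n) := by
  rcases eq_or_ne s (clusterFinset hA hδ) with rfl | hne
  · rw [pieceMart_clusterFinset]; exact stronglyAdapted_drvK_brownianCPath κ
  · rw [pieceMart_of_ne hs hne]; exact stronglyAdapted_imgMartK n

/-- The piece martingales are strongly progressive. [folklore] -/
theorem isStronglyProgressive_pieceMart {s : Finset (Set ℂ)} (hs : s ⊆ clusterFinset hA hδ) (n : ℕ) :
    IsStronglyProgressive brownianFiltration (pieceMart κ hA hδ s n) :=
  (stronglyAdapted_pieceMart hs n).isStronglyProgressive_of_continuous (continuous_pieceMart hs n)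

/-- **The piece clocks are adapted** with continuous nondecreasing `1`-Lipschitz paths from `0`. [folklore] -/
theorem pieceClock_spec {s : Finset (Set ℂ)} (hs : s ⊆ clusterFinset hA hδ) (n : ℕ) :
    Adapted brownianFiltration (pieceClock κ hA hδ s n) ∧ (∀ ω, Continuous fun t ↦ pieceClock κ hA hδ s n t ω) ∧
      (∀ ω, pieceClock κ hA hδ s n 0 ω = 0) ∧
      (∀ ω ⦃u v : ℝ≥0⦄, u ≤ v → pieceClock κ hA hδ s n u ω ≤ pieceClock κ hA hδ s n v ω ∧
        pieceClock κ hA hδ s n v ω - pieceClock κ hA hδ s n u ω ≤ (v : ℝ) - u) := by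
  rcases eq_or_ne s (clusterFinset hA hδ) with rfl | hne
  · rw [pieceClock_clusterFinset]
    exact ⟨fun _ ↦ measurable_const, fun ω ↦ NNReal.continuous_coe, fun ω ↦ rfl,
      fun ω u v huv ↦ ⟨NNReal.coe_le_coe.2 huv, le_rfl⟩⟩
  · rw [pieceClock_of_ne hs hne]
    exact ⟨adapted_imgClockK n, continuous_imgClockK n, imgClockK_zero n,
      fun ω u v huv ↦ ⟨imgClockK_mono n ω huv, imgClockK_sub_le huv ω⟩⟩

/-- `0 ≤ pieceClock t ≤ t`. [folklore] -/
theorem pieceClock_mem_Icc {s : Finset (Set ℂ)} (hs : s ⊆ clusterFinset hA hδ) (n : ℕ) (t : ℝ≥0) (ω : ℝ≥0 → ℝ) :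
    pieceClock κ hA hδ s n t ω ∈ Icc (0 : ℝ) t := by
  obtain ⟨-, -, h0, hmono⟩ := pieceClock_spec (κ := κ) hs n
  have h := hmono ω (show (0 : ℝ≥0) ≤ t from bot_le)
  rw [h0 ω] at h
  simpa using h

/-- **The driving process `W = √6 B` is a martingale** of the Brownian filtration. [cite: RevuzYor1999, Ch. II Prop. (1.2)(i)] -/
theorem martingale_drvK_brownianCPath :
    Martingale (fun t (ω : ℝ≥0 → ℝ) ↦ drvK 6 (brownianCPath ω) t) brownianFiltration Process.preWienerMeasure := by
  have heq : (fun t (ω : ℝ≥0 → ℝ) ↦ drvK 6 (brownianCPath ω) t) = Real.sqrt 6 • Process.brownian := by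
    funext t ω
    simp only [drvK, brownianCPath_apply, Process.brownian_zero, Pi.zero_apply, sub_zero, Pi.smul_apply, smul_eq_mul,
      NNReal.coe_ofNat]
  rw [heq]
  exact martingale_brownian_holds.smul _

/-- **`W² − 6t` is a martingale** (`W = √6 B`). [cite: RevuzYor1999, Ch. II Prop. (1.2)(ii)] -/
theorem martingale_drvK_sq_sub :
    Martingale (fun t (ω : ℝ≥0 → ℝ) ↦ drvK 6 (brownianCPath ω) t ^ 2 - 6 * (t : ℝ)) brownianFiltration Process.preWienerMeasure := by
  have heq : (fun t (ω : ℝ≥0 → ℝ) ↦ drvK 6 (brownianCPath ω) t ^ 2 - 6 * (t : ℝ)) =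
      (6 : ℝ) • fun t (ω : ℝ≥0 → ℝ) ↦ Process.brownian t ω ^ 2 - (t : ℝ) := by
    funext t ω
    simp only [drvK, brownianCPath_apply, Process.brownian_zero, Pi.zero_apply, sub_zero, Pi.smul_apply, smul_eq_mul,
      mul_pow, NNReal.coe_ofNat, Real.sq_sqrt (by norm_num : (0 : ℝ) ≤ 6)]
    ring
  rw [heq]
  exact martingale_brownian_sq_sub_holds.smul _

/-- **The piece martingales are martingales** (at `κ = 6`). [cite: LawlerSchrammWerner2001, Thm. 2.2] -/
theorem martingale_pieceMart {hA : IsStarHull A} {hδ : 0 < δ} {s : Finset (Set ℂ)} (hs : s ⊆ clusterFinset hA hδ) (n : ℕ) :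
    Martingale (pieceMart 6 hA hδ s n) brownianFiltration Process.preWienerMeasure := by
  rcases eq_or_ne s (clusterFinset hA hδ) with rfl | hne
  · rw [pieceMart_clusterFinset]; exact martingale_drvK_brownianCPath
  · rw [pieceMart_of_ne hs hne]; exact martingale_imgMartK

/-- **The compensated squares `(M^{s,n})² − 6 · pieceClock` are martingales** (at `κ = 6`).
[cite: LawlerSchrammWerner2001, Thm. 2.2] -/
theorem martingale_pieceMart_sq_sub {hA : IsStarHull A} {hδ : 0 < δ} {s : Finset (Set ℂ)} (hs : s ⊆ clusterFinset hA hδ) (n : ℕ) :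
    Martingale (fun t ω ↦ pieceMart 6 hA hδ s n t ω ^ 2 - 6 * pieceClock 6 hA hδ s n t ω) brownianFiltration
      Process.preWienerMeasure := by
  rcases eq_or_ne s (clusterFinset hA hδ) with rfl | hne
  · rw [pieceMart_clusterFinset, pieceClock_clusterFinset]; exact martingale_drvK_sq_sub
  · rw [pieceMart_of_ne hs hne, pieceClock_of_ne hs hne]; exact martingale_imgBracket

/-- **At an alive time of the piece hull the piece processes are eventually the image driving function and
the capacity clock of the piece hull** (the localising times exhaust the alive times,
`eventually_lt_imgLocTimeK`). [folklore] -/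
theorem eventually_pieceMart_eq {s : Finset (Set ℂ)} (hs : s ⊆ clusterFinset hA hδ) {u : ℝ≥0} {ω : ℝ≥0 → ℝ}
    (hu : Disjoint (closedHull (drvK κ (brownianCPath ω)) u) (pieceHull A s)) :
    ∀ᶠ n in atTop, pieceMart κ hA hδ s n u ω = imageDriver (drvK κ (brownianCPath ω)) (pieceHull A s) u ∧
      pieceClock κ hA hδ s n u ω = imageClock (drvK κ (brownianCPath ω)) (pieceHull A s) u := by
  rcases eq_or_ne s (clusterFinset hA hδ) with rfl | hne
  · simp only [pieceMart_clusterFinset, pieceClock_clusterFinset, pieceHull_clusterFinset]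
    exact Eventually.of_forall fun n ↦ ⟨(imageDriver_empty u).symm, (imageClock_empty _ u).symm⟩
  · simp only [pieceMart_of_ne hs hne, pieceClock_of_ne hs hne]
    filter_upwards [eventually_lt_imgLocTimeK (isStarHull_pieceHull hA hδ hs) (pieceHull_nonempty hA hδ hs hne) hu] with n hn
    have h0 : (0 : WithTop ℝ≥0) < imgLocTimeK κ (isStarHull_pieceHull hA hδ hs) (pieceHull_nonempty hA hδ hs hne) n ω :=
      lt_of_le_of_lt (by exact_mod_cast bot_le) hn
    exact ⟨imgMartK_eq_imageDriver hn.le h0, imgClockK_eq_imageClock hn.le h0⟩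

/-- **The piece martingales are bounded up to the cap time**: for `u ≤ capTimeK κ N` and `A ⊆ B̄(0, R)`,
`|M^{s,n}_u| ≤ (N+1) + 1160 (3(N+1) + 13 √u + R)`. [folklore] -/
theorem abs_pieceMart_le {s : Finset (Set ℂ)} (hs : s ⊆ clusterFinset hA hδ) {R : ℝ} (hR0 : 0 < R)
    (hAR : A ⊆ closedBall (0 : ℂ) R) {N : ℕ} (n : ℕ) {u : ℝ≥0} {ω : ℝ≥0 → ℝ} (hu : (u : WithTop ℝ≥0) ≤ capTimeK κ N ω) :
    |pieceMart κ hA hδ s n u ω| ≤ ((N : ℝ) + 1) + 1160 * (3 * ((N : ℝ) + 1) + 13 * Real.sqrt u + R) := by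
  have hpos : 0 ≤ 1160 * (3 * ((N : ℝ) + 1) + 13 * Real.sqrt u + R) := by positivity
  rcases eq_or_ne s (clusterFinset hA hδ) with rfl | hne
  · rw [pieceMart_clusterFinset]
    exact (abs_drvK_le_of_le_capTimeK hu).trans (le_add_of_nonneg_right hpos)
  · rw [pieceMart_of_ne hs hne, imgMartK_apply]
    set hB := isStarHull_pieceHull hA hδ hs
    set hBne := pieceHull_nonempty hA hδ hs hne
    set v : ℝ≥0 := (min (u : WithTop ℝ≥0) (imgLocTimeK κ hB hBne n ω)).untopA with hv
    have hvu : v ≤ u := Literature.Analysis.FunctionSpaces.untopA_min_le _ _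
    have hM : ∀ s' : ℝ≥0, s' ≤ v → |drvK κ (brownianCPath ω) s'| ≤ (N : ℝ) + 1 := fun s' hs' ↦
      abs_drvK_le_of_le_capTimeK ((WithTop.coe_le_coe.2 (hs'.trans hvu)).trans hu)
    have hn0 : (0 : ℝ) ≤ (N : ℝ) + 1 := by positivity
    have hBR : pieceHull A s ⊆ closedBall (0 : ℂ) R := (pieceHull_subset A s).trans hAR
    have e1 := (abs_LhatFnK_le (κ := κ) (hA := hB) (hne := hBne) n v (brownianCPath ω)).trans
      (abs_LFnK_le hB hR0 hBR hn0 hM)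
    have e0 := (abs_LhatFnK_le (κ := κ) (hA := hB) (hne := hBne) n 0 (brownianCPath ω)).trans
      (abs_LFnK_le hB hR0 hBR hn0 fun s' hs' ↦ hM s' (hs'.trans bot_le))
    have hsq0 : Real.sqrt ((0 : ℝ≥0) : ℝ) ≤ Real.sqrt u := Real.sqrt_le_sqrt (by positivity)
    have hsqv : Real.sqrt (v : ℝ) ≤ Real.sqrt u := Real.sqrt_le_sqrt (by exact_mod_cast hvu)
    rw [imgDrvP_def, imgDrvFnK_def]
    calc _ ≤ |drvK κ (brownianCPath ω) v + LhatFnK κ hB hBne n 0 (brownianCPath ω)| + |LhatFnK κ hB hBne n v (brownianCPath ω)| :=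
          abs_sub _ _
      _ ≤ |drvK κ (brownianCPath ω) v| + |LhatFnK κ hB hBne n 0 (brownianCPath ω)| + |LhatFnK κ hB hBne n v (brownianCPath ω)| := by
          gcongr; exact abs_add_le _ _
      _ ≤ ((N : ℝ) + 1) + 580 * (3 * ((N : ℝ) + 1) + 13 * Real.sqrt ((0 : ℝ≥0) : ℝ) + R) +
            580 * (3 * ((N : ℝ) + 1) + 13 * Real.sqrt (v : ℝ) + R) := by gcongr; exact hM v le_rfl
      _ ≤ _ := by nlinarith [hsq0, hsqv, Real.sqrt_nonneg (u : ℝ)]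

/-- **Limit of the piece processes at the contact time of the piece hull** (`T_{B_s} = u`, alive part at `u`
closed): `M^{s,n}_u → W_u + L_{B_s} − L_{slidHull W (B_s ∖ K̂_u) u}` and `pieceClock^{s,n}_u → imageClock W B_s u`
(the localising times increase to `u`; `Loewner.tendsto_starShift_slidHull_hullHitTime`).
[cite: Lawler2005, §6.3 (continuity of U*_t)] -/
theorem tendsto_pieceMart_of_hullHitTime_eq {s : Finset (Set ℂ)} (hs : s ⊆ clusterFinset hA hδ) (hne : s ≠ clusterFinset hA hδ)
    {u : ℝ≥0} {ω : ℝ≥0 → ℝ} (hT : hullHitTime (drvK κ (brownianCPath ω)) (pieceHull A s) = u)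
    (hcl : IsClosed (pieceHull A s \ closedHull (drvK κ (brownianCPath ω)) u))
    (hint : IntervalIntegrable (imageClockRate (drvK κ (brownianCPath ω)) (pieceHull A s)) volume 0 u) :
    Tendsto (fun n ↦ pieceMart κ hA hδ s n u ω) atTop
        (𝓝 (drvK κ (brownianCPath ω) u + (starShift (pieceHull A s)).re -
          (starShift (slidHull (drvK κ (brownianCPath ω)) (pieceHull A s \ closedHull (drvK κ (brownianCPath ω)) u) u)).re)) ∧
      Tendsto (fun n ↦ pieceClock κ hA hδ s n u ω) atTop (𝓝 (imageClock (drvK κ (brownianCPath ω)) (pieceHull A s) u)) := by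
  set W := drvK κ (brownianCPath ω) with hWdef
  set B := pieceHull A s with hBdef
  have hB : IsStarHull B := isStarHull_pieceHull hA hδ hs
  have hBne : B.Nonempty := pieceHull_nonempty hA hδ hs hne
  have hWc : Continuous W := continuous_drvK κ _
  have hW0 : W 0 = 0 := drvK_zero κ _
  simp only [pieceMart_of_ne hs hne, pieceClock_of_ne hs hne]
  set loc : ℕ → WithTop ℝ≥0 := fun n ↦ imgLocTimeK κ hB hBne n ω with hloc
  set v : ℕ → ℝ≥0 := fun n ↦ (loc n).untopA with hv
  have hvcoe : ∀ n, (v n : WithTop ℝ≥0) = loc n := fun n ↦ by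
    have hx : loc n ≠ ⊤ := imgLocTimeK_ne_top n ω
    show (((loc n).untopA : ℝ≥0) : WithTop ℝ≥0) = loc n
    rw [WithTop.untopA_eq_untop hx, WithTop.coe_untop]
  -- the piece hull is dead at `u`, alive before
  have hdead : ¬ Disjoint (closedHull W u) B := fun h ↦ by
    have := (disjoint_closedHull_iff_lt_hullHitTime hWc hB hBne).1 h
    rw [hT] at this
    exact lt_irrefl _ this
  have halive : ∀ u' < u, Disjoint (closedHull W u') B := fun u' hu' ↦
    disjoint_closedHull_of_lt_hullHitTime (by rw [hT]; exact_mod_cast hu')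
  -- `loc n ≤ u`
  have hlocle : ∀ n, loc n ≤ u := by
    intro n
    have hR : RpK κ hB hBne u ω = 0 := by
      have h1 := RFnK_nonneg (κ := κ) (hA := hB) (hne := hBne) u (brownianCPath ω)
      have h2 : ¬ 0 < RFnK κ hB hBne u (brownianCPath ω) := fun h ↦ hdead ((RFnK_pos_iff u _).1 h)
      exact le_antisymm (not_lt.1 h2) h1
    have hmem : RpK κ hB hBne u ω ∈ Iic (locLevel n) := by rw [hR]; exact (locLevel_pos_le n).1.le
    calc loc n ≤ locTimeK κ hB hBne n ω := imgLocTimeK_le_locTimeK n ω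
      _ ≤ hittingAfter (RpK κ hB hBne) (Iic (locLevel n)) 0 ω := (min_le_left _ _).trans (min_le_left _ _)
      _ ≤ u := hittingAfter_le_of_mem bot_le hmem
  have hvle : ∀ n, v n ≤ u := fun n ↦ by have := hlocle n; rw [← hvcoe] at this; exact WithTop.coe_le_coe.1 this
  -- eventually `0 < loc n`, and then the processes are the alive objects at `v n < u`
  have h0 : ∀ᶠ n in atTop, (0 : WithTop ℝ≥0) < loc n := by
    have := eventually_lt_imgLocTimeK (κ := κ) hB hBne (ω := ω) (t := 0) (disjoint_closedHull_zeroK hB _)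
    exact this
  have hvlt : ∀ᶠ n in atTop, v n < u := by
    filter_upwards [h0] with n hn
    refine lt_of_le_of_ne (hvle n) fun heq ↦ hdead ?_
    have := (imgDrvP_eq_of_le (κ := κ) (hA := hB) (hne := hBne) (n := n) (t := v n) (by rw [hvcoe]) hn).1
    rwa [heq] at this
  have hvtend : Tendsto v atTop (𝓝 u) := by
    refine tendsto_order.2 ⟨fun u' hu' ↦ ?_, fun u' hu' ↦ Eventually.of_forall fun n ↦ (hvle n).trans_lt hu'⟩
    filter_upwards [eventually_lt_imgLocTimeK (κ := κ) hB hBne (halive u' hu')] with n hn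
    have hn' : ((u' : ℝ≥0) : WithTop ℝ≥0) < v n := by rw [hvcoe]; exact hn
    exact_mod_cast hn'
  have hvtend' : Tendsto v atTop (𝓝[<] u) := tendsto_nhdsWithin_iff.2 ⟨hvtend, hvlt⟩
  constructor
  · have hev : ∀ᶠ n in atTop, imgMartK κ hB hBne n u ω = W (v n) + (starShift B).re - (starShift (slidHull W B (v n))).re := by
      filter_upwards [h0] with n hn
      rw [imgMartK_apply]
      have hmin : (min (u : WithTop ℝ≥0) (loc n)).untopA = v n := by rw [min_eq_right (hlocle n)]
      rw [hmin, (imgDrvP_eq_of_le (κ := κ) (hA := hB) (hne := hBne) (n := n) (t := v n) (by rw [hvcoe]) hn).2.2, imageDriver]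
    refine Tendsto.congr' (EventuallyEq.symm hev) ?_
    have hL := (tendsto_starShift_slidHull_hullHitTime hWc hW0 hB hBne hT hcl).comp hvtend'
    exact ((hWc.tendsto u |>.comp hvtend).add tendsto_const_nhds).sub hL
  · have hev : ∀ᶠ n in atTop, imgClockK κ hB hBne n u ω = imageClock W B (v n) := by
      filter_upwards [h0] with n hn
      have h1 : imgClockK κ hB hBne n u ω = imgClockK κ hB hBne n (v n) ω := by
        rw [imgClockK_eq_timeIntegral_min, imgClockK_eq_timeIntegral_min, min_eq_right (hlocle n), min_eq_left (hvcoe n).le]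
        rfl
      rw [h1, imgClockK_eq_imageClock (by rw [hvcoe]) hn]
    refine Tendsto.congr' (EventuallyEq.symm hev) ?_
    have hint' : IntegrableOn (imageClockRate W B) (uIcc (0 : ℝ) u) volume := by
      rw [uIcc_of_le u.coe_nonneg]; exact (intervalIntegrable_iff_integrableOn_Icc_of_le u.coe_nonneg).1 hint
    have hcont : ContinuousOn (imageClock W B) (uIcc (0 : ℝ) u) := by
      have h := intervalIntegral.continuousOn_primitive_interval (μ := volume) hint'
      have heq : (fun x ↦ ∫ t in (0 : ℝ)..x, imageClockRate W B t) = imageClock W B := by funext x; rw [imageClock]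
      rwa [heq] at h
    have hu0 : (u : ℝ) ∈ uIcc (0 : ℝ) u := by rw [uIcc_of_le u.coe_nonneg]; exact ⟨u.coe_nonneg, le_rfl⟩
    have h1 := (hcont u hu0).tendsto
    have h2 : Tendsto (fun n ↦ ((v n : ℝ≥0) : ℝ)) atTop (𝓝[uIcc (0 : ℝ) u] u) := by
      refine tendsto_nhdsWithin_iff.2 ⟨NNReal.continuous_coe.continuousAt.tendsto.comp hvtend, Eventually.of_forall fun n ↦ ?_⟩
      rw [uIcc_of_le u.coe_nonneg]; exact ⟨(v n).coe_nonneg, by exact_mod_cast hvle n⟩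
    exact h1.comp h2

end PieceMart

end Literature.Probability.RandomPlanarGeometry

end
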